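import Literature.Geometry.Lorentzian.Volume
import Mathlib.Geometry.Manifold.Riemannian.Basic
import Mathlib.Geometry.Euclidean.Volume.Measure
import HarnessLib

/-!
# The Riemannian distance and measure are invariant under isometric diffeomorphisms
(topic `Geometry/Riemannian`)

For the tree's Riemannian volumes `riemannianVolume h d` / `riemannianMeasure h` (`Volume.lean`:
the Euclidean-normalised Hausdorff measures `μHE[d]` of Mathlib's Riemannian length metric
`riemannianEDist`, O'Neill 1983, Ch. 3; Federer 1969, §3.2.46; Chavel 2006, §III.3) we PROVE the
basic naturality: a `C¹` diffeomorphism `Ψ : M₁ → M₂` with `g₂(dΨ v, dΨ v) = g₁(v, v)`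
(`g₁ = Ψ^* g₂`) is an isometry of the length metrics and hence measure preserving.

* `pathELength_comp_of_enorm_mfderiv` — a differentiable map with isometric differential preserves
  lengths of paths; `riemannianEDist_comp_le`, `riemannianEDist_comp_eq` — it does not increase,
  and a diffeomorphism preserves, the Riemannian distance (stated for arbitrary extended norms on
  the tangent spaces, as in `Mathlib.Geometry.Manifold.Riemannian.PathELength`);
* `measurePreserving_riemannianVolume` — `Ψ_* vol^d_{g₁} = vol^d_{g₂}` for every `d`
  (`IsometryEquiv.measurePreserving_euclideanHausdorffMeasure`);
* `measurePreserving_riemannianMeasure`, `integral_comp_of_isometry` — in equal dimensions,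
  `Ψ_* dvol_{g₁} = dvol_{g₂}` and `∫ f ∘ Ψ dvol_{g₁} = ∫ f dvol_{g₂}`.

In particular the Riemannian measure does not depend on the model space charting the manifold
(any change of model is an isometric diffeomorphism for the transported metric) — the plumbing by
which results proved for manifolds modelled on `ℝ^m` (divergence theorem, first variation of
the energy, `EnergyFirstVariation.lean`) transfer to arbitrary models. Everything is proved; there
are no definitions and no named facts.

## References

* B. O'Neill, *Semi-Riemannian Geometry* (1983), Ch. 3, pp. 58, 90–91 (isometries preserve arc
  length and distance). [ONeill1983]
* H. Federer, *Geometric Measure Theory* (1969), §2.10.2, §3.2.46. [Federer1969]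
* I. Chavel, *Riemannian Geometry: A Modern Introduction*, 2nd ed. (2006), §III.3. [Chavel2006]
-/

noncomputable section

open Bundle Set Function Filter MeasureTheory Manifold
open scoped Manifold ContDiff Topology ENNReal

namespace Literature.Geometry.Riemannian

variable {E₁ : Type*} [NormedAddCommGroup E₁] [NormedSpace ℝ E₁] {H₁ : Type*} [TopologicalSpace H₁]
  {I₁ : ModelWithCorners ℝ E₁ H₁} {M₁ : Type*} [TopologicalSpace M₁] [ChartedSpace H₁ M₁]
  {E₂ : Type*} [NormedAddCommGroup E₂] [NormedSpace ℝ E₂] {H₂ : Type*} [TopologicalSpace H₂]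
  {I₂ : ModelWithCorners ℝ E₂ H₂} {M₂ : Type*} [TopologicalSpace M₂] [ChartedSpace H₂ M₂]

/-! ### Lengths of paths and the Riemannian distance under maps with isometric differential -/

section ENorm

variable [∀ x : M₁, ENorm (TangentSpace I₁ x)] [∀ y : M₂, ENorm (TangentSpace I₂ y)]
  {Ψ : M₁ → M₂}

/-- **A differentiable map with isometric differential preserves the lengths of paths**:
if `‖dΨ_x v‖ = ‖v‖` for all tangent vectors, then `L(Ψ ∘ γ) = L(γ)` on `[a, b]` for every path
`γ` differentiable on `[a, b]` (chain rule under the length integral, off the two endpoints).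
O'Neill 1983, Ch. 3, pp. 58, 90 (isometries preserve arc length). [cite: ONeill1983, Ch. 3, p. 90] -/
theorem pathELength_comp_of_enorm_mfderiv (hΨ : ∀ x, MDifferentiableAt I₁ I₂ Ψ x)
    (hiso : ∀ x (v : TangentSpace I₁ x), ‖mfderiv I₁ I₂ Ψ x v‖ₑ = ‖v‖ₑ)
    {γ : ℝ → M₁} {a b : ℝ} (hγ : MDiff[Icc a b] γ) :
    pathELength I₂ (Ψ ∘ γ) a b = pathELength I₁ γ a b := by
  rw [pathELength_eq_lintegral_mfderiv_Ioo, pathELength_eq_lintegral_mfderiv_Ioo]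
  refine setLIntegral_congr_fun measurableSet_Ioo fun t ht ↦ ?_
  have hγt : MDifferentiableAt 𝓘(ℝ, ℝ) I₁ γ t :=
    (hγ t (Ioo_subset_Icc_self ht)).mdifferentiableAt (Icc_mem_nhds ht.1 ht.2)
  rw [mfderiv_comp t (hΨ (γ t)) hγt]
  exact hiso (γ t) _

variable [∀ x : M₁, ENormSMulClass ℝ (TangentSpace I₁ x)] [∀ y : M₂, ENormSMulClass ℝ (TangentSpace I₂ y)]

omit [∀ x : M₁, ENormSMulClass ℝ (TangentSpace I₁ x)] in
/-- **A `C¹` map with isometric differential does not increase the Riemannian distance**: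
`d(Ψ x, Ψ y) ≤ d(x, y)` (push forward almost-minimising `C¹` paths). [cite: ONeill1983, Ch. 3, p. 90] -/
theorem riemannianEDist_comp_le (hΨ : ContMDiff I₁ I₂ 1 Ψ)
    (hiso : ∀ x (v : TangentSpace I₁ x), ‖mfderiv I₁ I₂ Ψ x v‖ₑ = ‖v‖ₑ) (x y : M₁) :
    riemannianEDist I₂ (Ψ x) (Ψ y) ≤ riemannianEDist I₁ x y := by
  refine le_of_forall_gt_imp_ge_of_dense fun r hr ↦ le_of_lt ?_
  obtain ⟨γ, h0, h1, hγ, hlen⟩ := exists_lt_of_riemannianEDist_lt hr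
  have hΨγ : CMDiff[Icc 0 1] 1 (Ψ ∘ γ) := hΨ.comp_contMDiffOn hγ
  calc riemannianEDist I₂ (Ψ x) (Ψ y) ≤ pathELength I₂ (Ψ ∘ γ) 0 1 :=
        riemannianEDist_le_pathELength hΨγ (by simp [h0]) (by simp [h1]) zero_le_one
    _ = pathELength I₁ γ 0 1 := pathELength_comp_of_enorm_mfderiv
        (fun x ↦ (hΨ x).mdifferentiableAt one_ne_zero) hiso (hγ.mdifferentiableOn one_ne_zero)
    _ < r := hlen

/-- **A `C¹` diffeomorphism with isometric differential preserves the Riemannian distance**: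
`d(Ψ x, Ψ y) = d(x, y)` (the inverse also has isometric differential). O'Neill 1983, Ch. 3,
p. 91 (isometries preserve Riemannian distance). [cite: ONeill1983, Ch. 3, p. 91] -/
theorem riemannianEDist_comp_eq {Ψ' : M₂ → M₁} (hΨ : ContMDiff I₁ I₂ 1 Ψ)
    (hΨ' : ContMDiff I₂ I₁ 1 Ψ') (hleft : LeftInverse Ψ' Ψ) (hright : RightInverse Ψ' Ψ)
    (hiso : ∀ x (v : TangentSpace I₁ x), ‖mfderiv I₁ I₂ Ψ x v‖ₑ = ‖v‖ₑ) (x y : M₁) :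
    riemannianEDist I₂ (Ψ x) (Ψ y) = riemannianEDist I₁ x y := by
  refine le_antisymm (riemannianEDist_comp_le hΨ hiso x y) ?_
  -- the inverse has isometric differential too
  have hiso' : ∀ z (w : TangentSpace I₂ z), ‖mfderiv I₂ I₁ Ψ' z w‖ₑ = ‖w‖ₑ := by
    intro z w
    have hd : MDifferentiableAt I₂ I₁ Ψ' z := (hΨ' z).mdifferentiableAt one_ne_zero
    have hd2 : MDifferentiableAt I₁ I₂ Ψ (Ψ' z) := (hΨ (Ψ' z)).mdifferentiableAt one_ne_zero
    have hcomp : mfderiv I₂ I₂ (Ψ ∘ Ψ') z = (mfderiv I₁ I₂ Ψ (Ψ' z)).comp (mfderiv I₂ I₁ Ψ' z) :=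
      mfderiv_comp z hd2 hd
    have hid : mfderiv I₂ I₂ (Ψ ∘ Ψ') z = ContinuousLinearMap.id ℝ (TangentSpace I₂ z) := by
      have : Ψ ∘ Ψ' = id := funext hright
      rw [this, mfderiv_id]
    have happ : mfderiv I₁ I₂ Ψ (Ψ' z) (mfderiv I₂ I₁ Ψ' z w) = w := by
      exact DFunLike.congr_fun (hcomp.symm.trans hid) w
    rw [← hiso (Ψ' z) (mfderiv I₂ I₁ Ψ' z w), happ]
    exact congrArg (fun z' : M₂ ↦ ‖(show TangentSpace I₂ z' from w)‖ₑ) (hright z)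
  have := riemannianEDist_comp_le hΨ' hiso' (Ψ x) (Ψ y)
  rwa [hleft x, hleft y] at this

end ENorm

/-! ### The Riemannian volume and measure under isometric diffeomorphisms -/

section Volume

variable [IsManifold I₁ 1 M₁] [T3Space M₁] [MeasurableSpace M₁] [BorelSpace M₁]
  [IsManifold I₂ 1 M₂] [T3Space M₂] [MeasurableSpace M₂] [BorelSpace M₂] {n : ℕ∞ω}
  (g₁ : ContMDiffRiemannianMetric I₁ n E₁ (TangentSpace I₁ : M₁ → Type _))
  (g₂ : ContMDiffRiemannianMetric I₂ n E₂ (TangentSpace I₂ : M₂ → Type _))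
  {Ψ : M₁ → M₂} {Ψ' : M₂ → M₁}

/-- **The Riemannian volumes are invariant under isometric diffeomorphisms**: if `Ψ : M₁ → M₂` is
a `C¹` diffeomorphism with `g₂(dΨ v, dΨ v) = g₁(v, v)` (i.e. `g₁ = Ψ^* g₂`), then `Ψ` pushes the
`d`-dimensional Riemannian volume of `(M₁, g₁)` forward to that of `(M₂, g₂)`, for every `d`
(`Ψ` is an isometry of the Riemannian length metrics, `riemannianEDist_comp_eq`, and the
Euclidean-normalised Hausdorff measures are isometry invariants,
`IsometryEquiv.measurePreserving_euclideanHausdorffMeasure`). Federer 1969, §2.10.2 and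
§3.2.46; Chavel 2006, §III.3. [cite: Federer1969, §3.2.46] -/
theorem measurePreserving_riemannianVolume (hΨ : ContMDiff I₁ I₂ 1 Ψ)
    (hΨ' : ContMDiff I₂ I₁ 1 Ψ') (hleft : LeftInverse Ψ' Ψ) (hright : RightInverse Ψ' Ψ)
    (hiso : ∀ x (v : TangentSpace I₁ x),
      g₂.inner (Ψ x) (mfderiv I₁ I₂ Ψ x v) (mfderiv I₁ I₂ Ψ x v) = g₁.inner x v v) (d : ℕ) :
    MeasurePreserving Ψ (Lorentzian.riemannianVolume g₁ d) (Lorentzian.riemannianVolume g₂ d) := by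
  letI iR₁ : RiemannianBundle (fun x : M₁ ↦ TangentSpace I₁ x) :=
    ⟨g₁.toContinuousRiemannianMetric.toRiemannianMetric⟩
  letI iR₂ : RiemannianBundle (fun x : M₂ ↦ TangentSpace I₂ x) :=
    ⟨g₂.toContinuousRiemannianMetric.toRiemannianMetric⟩
  letI iE₁ : EMetricSpace M₁ := EMetricSpace.ofRiemannianMetric I₁ M₁
  letI iE₂ : EMetricSpace M₂ := EMetricSpace.ofRiemannianMetric I₂ M₂
  -- the differential is isometric for the fibre norms
  have hnorm : ∀ x (v : TangentSpace I₁ x), ‖mfderiv I₁ I₂ Ψ x v‖ = ‖v‖ := by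
    intro x v
    have h1 : ‖mfderiv I₁ I₂ Ψ x v‖ ^ 2 = ‖v‖ ^ 2 := by
      rw [← real_inner_self_eq_norm_sq, ← real_inner_self_eq_norm_sq]
      exact hiso x v
    nlinarith [norm_nonneg (mfderiv I₁ I₂ Ψ x v), norm_nonneg v, sq_nonneg (‖mfderiv I₁ I₂ Ψ x v‖ - ‖v‖),
      sq_nonneg (‖mfderiv I₁ I₂ Ψ x v‖ + ‖v‖)]
  have henorm : ∀ x (v : TangentSpace I₁ x), ‖mfderiv I₁ I₂ Ψ x v‖ₑ = ‖v‖ₑ := fun x v ↦ by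
    rw [← ofReal_norm, ← ofReal_norm, hnorm x v]
  -- `Ψ` is an isometric equivalence of the length metrics
  have hedist : ∀ x y : M₁, edist (Ψ x) (Ψ y) = edist x y := fun x y ↦
    riemannianEDist_comp_eq hΨ hΨ' hleft hright henorm x y
  let e : M₁ ≃ᵢ M₂ := ⟨⟨Ψ, Ψ', hleft, hright⟩, fun x y ↦ hedist x y⟩
  exact e.measurePreserving_euclideanHausdorffMeasure d

/-- **The Riemannian measure is invariant under isometric diffeomorphisms between manifolds of
the same dimension**: `Ψ_* dvol_{g₁} = dvol_{g₂}` for a `C¹` diffeomorphism with `g₁ = Ψ^* g₂`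
(`measurePreserving_riemannianVolume` in the top dimension). In particular the Riemannian measure
does not depend on the model space used to chart the manifold. Chavel 2006, §III.3; Federer 1969,
§3.2.46. [cite: Federer1969, §3.2.46] -/
theorem measurePreserving_riemannianMeasure (hΨ : ContMDiff I₁ I₂ 1 Ψ)
    (hΨ' : ContMDiff I₂ I₁ 1 Ψ') (hleft : LeftInverse Ψ' Ψ) (hright : RightInverse Ψ' Ψ)
    (hiso : ∀ x (v : TangentSpace I₁ x),
      g₂.inner (Ψ x) (mfderiv I₁ I₂ Ψ x v) (mfderiv I₁ I₂ Ψ x v) = g₁.inner x v v)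
    (hdim : Module.finrank ℝ E₁ = Module.finrank ℝ E₂) :
    MeasurePreserving Ψ (Lorentzian.riemannianMeasure g₁) (Lorentzian.riemannianMeasure g₂) := by
  rw [Lorentzian.riemannianMeasure, Lorentzian.riemannianMeasure, hdim]
  exact measurePreserving_riemannianVolume g₁ g₂ hΨ hΨ' hleft hright hiso _

/-- **Change of variables for the Riemannian measure under an isometric diffeomorphism**:
`∫ f(Ψ x) dvol_{g₁}(x) = ∫ f dvol_{g₂}` for every `f : M₂ → F` (no integrability needed: `Ψ` is a
measurable equivalence). [cite: Federer1969, §3.2.46] -/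
theorem integral_comp_of_isometry {F : Type*} [NormedAddCommGroup F] [NormedSpace ℝ F]
    (hΨ : ContMDiff I₁ I₂ 1 Ψ) (hΨ' : ContMDiff I₂ I₁ 1 Ψ') (hleft : LeftInverse Ψ' Ψ)
    (hright : RightInverse Ψ' Ψ)
    (hiso : ∀ x (v : TangentSpace I₁ x),
      g₂.inner (Ψ x) (mfderiv I₁ I₂ Ψ x v) (mfderiv I₁ I₂ Ψ x v) = g₁.inner x v v)
    (hdim : Module.finrank ℝ E₁ = Module.finrank ℝ E₂) (f : M₂ → F) :
    ∫ x, f (Ψ x) ∂Lorentzian.riemannianMeasure g₁ = ∫ y, f y ∂Lorentzian.riemannianMeasure g₂ := by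
  have hΨe : MeasurableEmbedding Ψ :=
    (Homeomorph.mk ⟨Ψ, Ψ', hleft, hright⟩ hΨ.continuous hΨ'.continuous).measurableEmbedding
  exact (measurePreserving_riemannianMeasure g₁ g₂ hΨ hΨ' hleft hright hiso hdim).integral_comp hΨe f

end Volume

end Literature.Geometry.Riemannian

end
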